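import Literature.NumberTheory.LFunctions.Zhang2022.RepairSection18Theta
import Literature.NumberTheory.LFunctions.Zhang2022.RepairSection9Theta

/-!
# Zhang (2022), repair rung F-S1R: the §18 constant `𝔠₃(θ)` is affine in `ῑ₃, ῑ₄` — coefficient
# functionals, the unreduced/reduced split, and the parametric `4 × 4` Hermitian form

Y. Zhang, *Discrete mean estimates and the Landau–Siegel zero*, arXiv:2211.02515v1 (2022)
[Zhang2022LandauSiegel] — an unrefereed manuscript under adjudication; nothing here is a claim about
its Theorems 1–2. Third file of the repair rung (human ruling D-0077), pure algebra over the
θ-generic definitions of `RepairSection18Theta`: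

* provenance / dedup bridges for the generic profiles (typer-liaison note of the rung): `ffR_eq_frakf`,
  `ghR_eq_frakg` — the ℝ-typed profiles `Repair.ffR/ghR` of `RepairTheta` ARE the main terms
  `Section8MainTerms.frakf/frakg` of Lemmas 8.2/8.4 at `(β_j, β_μ) = (jπi, kπi)` for ALL real `j, k`
  (formula faithfulness off `θ₀` by theorem); `ffT_eq_ffMain`, `ghT_one/two/three_eq_ghMain` — on
  `ℚ × {1,2,3}` they coincide with the ℚ-typed `ffMain/ghMain` of `RepairSection9Theta` (rule of one:
  θ-generic statements quote `Repair.ffT/ghT`, box/point certificates quote `ffMain/ghMain`).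
* `e2starT_eq`: `e₂*(θ) = ῑ₃ g₃(θ) + ῑ₄ g₄(θ)`; `frakc3rT_eq`: the reduced (18.1)
  `𝔠₃ʳ(θ) = ῑ₃F₂₀(θ) + ῑ₃ι₂F₂₁(θ) + ῑ₄F₃₀(θ) + ῑ₄ι₂F₃₁(θ)` with coefficient functionals
  `F20T … F31T` of the STRUCTURAL coordinates `(ν, k, cut₁)` only (`…_withIota : rfl`) — the
  θ-generic form of `Section18AllIota.frakc3rG_eq`; regression `g3T/g4T/F··T (thetaIota w) = g3v/g4v/F··`.
* `frakc3T_eq_add`: `𝔠₃(θ) = 𝔠₃ʳ(θ) + identResidual(θ)` (the printed reduction step of §18 is the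
  claim `identResidual = ε`); `estar1T_eq`: `e*_{1j}(θ) = ῑ₃A₃ⱼ(θ) + ῑ₄A₂ⱼ(θ)` (linearity of the
  integral); `identResidualT_eq`: `identResidual(θ) = ῑ₃R₃(θ) + ῑ₄R₄(θ)`; hence `frakc3T_eq`: the
  UNREDUCED `𝔠₃(θ)` (the form inside `Skeleton.Margin232`) is affine in `ῑ` as well, with
  coefficients `F₂₀ + R₃`, `F₃₀ + R₄`.
* `QP c₁₁ c₁₂ c₂₂ c₃₃ c₃₄ c₄₄ F₂₀ F₂₁ F₃₀ F₃₁ m`: the matrix of `Section18AllIota.QM` with all ten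
  entries as parameters (`QP_eq_QM : … = QM c₃₄ m` by `rfl`), `form_QP` (the form identity, pure
  ring algebra), and the two bridges the cover/certificate seats consume:
  `C232T_form_re` — if `c₁ = c₁₁ + ι₂c̄₁₂ + ῑ₂c₁₂ + |ι₂|²c₂₂` and
  `c₂ = |ι₃|²c₃₃ + ι₃ῑ₄c₃₄ + ι₄ῑ₃c̄₃₄ + |ι₄|²c₄₄` then
  `Re(x* QP(…, F··(θ), m) x) = C232T θ c₁ c₂ − m`, `x = (1, ι₂, ι₃, ι₄)` — and
  `margin232LHS_form_re` (the same with `F₂₀ + R₃, F₃₀ + R₄`: `= margin232LHS θ c₁ c₂ − 2·10⁻⁵ − m`);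
  `C232T_ge_of_posSemidef`, `margin232LHS_ge_of_posSemidef`: positive semidefiniteness of the
  parametric matrix gives the floor `m` for THAT `θ` — for every `ι` with the same structural part.

No analytic content, no `Prop` facts, no statement about Theorems 1–2.
-/

noncomputable section

open Complex Real ComplexConjugate Matrix
open scoped ComplexOrder

namespace Literature.NumberTheory.LFunctions.Zhang2022

namespace Repair

/-! ### Provenance and dedup bridges for the generic profiles -/

/-- The θ-generic `𝔣𝔣`-profile IS Lemma 8.2's main term `𝔣_{jμ}` at `(β_j, β_μ) = (jπi, kπi)`, for all
real `j, k`. [cite: Zhang2022LandauSiegel, Lemma 8.2] -/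
theorem ffR_eq_frakf (j k z : ℝ) : ffR (k - j) k z = frakf (j * π * I) (k * π * I) z := by
  unfold ffR frakf; push_cast; ring_nf

/-- The θ-generic `𝔤𝔥`-profile IS Lemma 8.4's main term `𝔤` at `(β_{j′}, β_{j″}, β_μ) = (j₁πi, j₂πi, kπi)`,
for all real `j₁, j₂` and `k ≠ 0`. [cite: Zhang2022LandauSiegel, Lemma 8.4] -/
theorem ghR_eq_frakg (j1 j2 k z : ℝ) (hk : k ≠ 0) :
    ghR (j1 * j2 / k ^ 2) (1 - j1 * j2 / k ^ 2) (j1 + j2 - k - j1 * j2 / k) k z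
      = frakg (j1 * π * I) (j2 * π * I) (k * π * I) z := by
  unfold ghR frakg
  have hk' : (k : ℂ) ≠ 0 := by exact_mod_cast hk
  have hpi : (π : ℂ) ≠ 0 := by exact_mod_cast Real.pi_ne_zero
  have hI : I ≠ 0 := I_ne_zero
  push_cast
  field_simp
  ring_nf

/-- Dedup: on `ℚ × ℕ` the ℝ-typed `Repair.ffT` is `RepairSection9Theta`'s `ffMain`.
[cite: Zhang2022LandauSiegel, §8 (8.13)–(8.18)] -/
theorem ffT_eq_ffMain (k : ℚ) (j : ℕ) : ffT k j = ffMain k j := by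
  unfold ffT ffMain; rw [← ffR_ratCast]; push_cast; rfl

/-- Dedup: `Repair.ghT k 1 = ghMain k 2 3` (`(j′, j″) = (2, 3)`, `N₁ = 6`, `S₁ = 5`).
[cite: Zhang2022LandauSiegel, §8 (8.13), (8.16)] -/
theorem ghT_one_eq_ghMain (k : ℚ) : ghT k 1 = ghMain k 2 3 := by
  unfold ghT ghMain r0Main bMain bN bS
  rw [← ghR_ratCast]; push_cast; ring_nf

/-- Dedup: `Repair.ghT k 2 = ghMain k 3 1` (`N₂ = 3`, `S₂ = 4`). [cite: Zhang2022LandauSiegel, §8 (8.14), (8.17)] -/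
theorem ghT_two_eq_ghMain (k : ℚ) : ghT k 2 = ghMain k 3 1 := by
  unfold ghT ghMain r0Main bMain bN bS
  rw [← ghR_ratCast]; push_cast; ring_nf

/-- Dedup: `Repair.ghT k 3 = ghMain k 1 2` (`N₃ = 2`, `S₃ = 3`). [cite: Zhang2022LandauSiegel, §8 (8.15), (8.18)] -/
theorem ghT_three_eq_ghMain (k : ℚ) : ghT k 3 = ghMain k 1 2 := by
  unfold ghT ghMain r0Main bMain bN bS
  rw [← ghR_ratCast]; push_cast; ring_nf

/-! ### Replacing the `ι`-block of `θ` -/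

/-- `θ` with its `ι`-coordinates replaced by `(w₂, w₃, w₄)` (structural part unchanged).
[cite: Zhang2022LandauSiegel, (2.26)] -/
def Theta.withIota (θ : Theta) (w2 w3 w4 : ℂ) : Theta := { θ with iota2 := w2, iota3 := w3, iota4 := w4 }

/-- [cite: Zhang2022LandauSiegel, (2.26)] -/
@[simp] theorem Theta.withIota_iota2 (θ : Theta) (w2 w3 w4 : ℂ) : (θ.withIota w2 w3 w4).iota2 = w2 := rfl
/-- [cite: Zhang2022LandauSiegel, (2.26)] -/
@[simp] theorem Theta.withIota_iota3 (θ : Theta) (w2 w3 w4 : ℂ) : (θ.withIota w2 w3 w4).iota3 = w3 := rfl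
/-- [cite: Zhang2022LandauSiegel, (2.26)] -/
@[simp] theorem Theta.withIota_iota4 (θ : Theta) (w2 w3 w4 : ℂ) : (θ.withIota w2 w3 w4).iota4 = w4 := rfl
/-- `θ₀.withIota w = thetaIota w`. [cite: Zhang2022LandauSiegel, (2.26)] -/
theorem theta0_withIota (w2 w3 w4 : ℂ) : theta0.withIota w2 w3 w4 = thetaIota w2 w3 w4 := rfl

/-! ### `e₂*` and the reduced `𝔠₃` as affine functions of `ῑ₃, ῑ₄` -/

/-- coefficient of `ῑ₃` in `e₂*(θ)`: `g₃(θ) = (4/(ν₁π)) I₆(θ)/ν₃` (printed `−(500/63)/(249π)`).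
[cite: Zhang2022LandauSiegel, §12 (12.14)–(12.15)] -/
def g3T (θ : Theta) : ℂ := ((4 / (θ.nu1 * π) : ℝ) : ℂ) * I6T θ / (θ.nu3 : ℂ)

/-- coefficient of `ῑ₄` in `e₂*(θ)`: `g₄(θ) = (4/(ν₁π)) I₇(θ)/ν₂`. [cite: Zhang2022LandauSiegel, §12 (12.14)–(12.15)] -/
def g4T (θ : Theta) : ℂ := ((4 / (θ.nu1 * π) : ℝ) : ℂ) * I7T θ / (θ.nu2 : ℂ)

/-- `e₂*(θ) = ῑ₃ g₃(θ) + ῑ₄ g₄(θ)`. [cite: Zhang2022LandauSiegel, §12 (12.15)] -/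
theorem e2starT_eq (θ : Theta) : e2starT θ = conj θ.iota3 * g3T θ + conj θ.iota4 * g4T θ := by
  unfold e2starT g3T g4T; ring

/-- `F₂₀(θ)`: coefficient of `ῑ₃` in the reduced `𝔠₃(θ)`. [cite: Zhang2022LandauSiegel, §18 (18.1)] -/
def F20T (θ : Theta) : ℂ :=
  -I * (3 * (e1pT θ 1 * e3T θ 1) + 3 * (e1pT θ 2 * e3T θ 2) + e1pT θ 3 * e3T θ 3 + vk1T θ * vk3T θ) + 2 * g3T θ
/-- `F₂₁(θ)`: coefficient of `ῑ₃ι₂`. [cite: Zhang2022LandauSiegel, §18 (18.1)] -/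
def F21T (θ : Theta) : ℂ :=
  -I * (3 * (e2T θ 1 * e3T θ 1) + 3 * (e2T θ 2 * e3T θ 2) + e2T θ 3 * e3T θ 3 + vk2T θ * vk3T θ)
/-- `F₃₀(θ)`: coefficient of `ῑ₄`. [cite: Zhang2022LandauSiegel, §18 (18.1)] -/
def F30T (θ : Theta) : ℂ :=
  -I * (3 * (e1pT θ 1 * e2T θ 1) + 3 * (e1pT θ 2 * e2T θ 2) + e1pT θ 3 * e2T θ 3 + vk1T θ * vk4T θ) + 2 * g4T θ
/-- `F₃₁(θ)`: coefficient of `ῑ₄ι₂`. [cite: Zhang2022LandauSiegel, §18 (18.1)] -/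
def F31T (θ : Theta) : ℂ :=
  -I * (3 * (e2T θ 1 * e2T θ 1) + 3 * (e2T θ 2 * e2T θ 2) + e2T θ 3 * e2T θ 3 + vk2T θ * vk4T θ)

/-- **The reduced `𝔠₃(θ)` is affine in `ῑ₃, ῑ₄`**:
`𝔠₃ʳ(θ) = ῑ₃F₂₀(θ) + ῑ₃ι₂F₂₁(θ) + ῑ₄F₃₀(θ) + ῑ₄ι₂F₃₁(θ)` (θ-generic `Section18AllIota.frakc3rG_eq`).
[cite: Zhang2022LandauSiegel, §18 (18.1)–(18.2)] -/
theorem frakc3rT_eq (θ : Theta) :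
    frakc3rT θ = conj θ.iota3 * F20T θ + conj θ.iota3 * θ.iota2 * F21T θ + conj θ.iota4 * F30T θ
      + conj θ.iota4 * θ.iota2 * F31T θ := by
  unfold frakc3rT frakepT frake0T F20T F21T F30T F31T vk4T
  rw [e2starT_eq]
  ring

/-- The coefficient functionals do not see `ι`. [cite: Zhang2022LandauSiegel, §18 (18.1)] -/
theorem g3T_withIota (θ : Theta) (w2 w3 w4 : ℂ) : g3T (θ.withIota w2 w3 w4) = g3T θ := rfl
/-- [cite: Zhang2022LandauSiegel, §18 (18.1)] -/
theorem g4T_withIota (θ : Theta) (w2 w3 w4 : ℂ) : g4T (θ.withIota w2 w3 w4) = g4T θ := rfl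
/-- [cite: Zhang2022LandauSiegel, §18 (18.1)] -/
theorem F20T_withIota (θ : Theta) (w2 w3 w4 : ℂ) : F20T (θ.withIota w2 w3 w4) = F20T θ := rfl
/-- [cite: Zhang2022LandauSiegel, §18 (18.1)] -/
theorem F21T_withIota (θ : Theta) (w2 w3 w4 : ℂ) : F21T (θ.withIota w2 w3 w4) = F21T θ := rfl
/-- [cite: Zhang2022LandauSiegel, §18 (18.1)] -/
theorem F30T_withIota (θ : Theta) (w2 w3 w4 : ℂ) : F30T (θ.withIota w2 w3 w4) = F30T θ := rfl
/-- [cite: Zhang2022LandauSiegel, §18 (18.1)] -/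
theorem F31T_withIota (θ : Theta) (w2 w3 w4 : ℂ) : F31T (θ.withIota w2 w3 w4) = F31T θ := rfl

/-- regression: `g₃(θ_ι) = g3v` of `Section18AllIota` (`−0.002·4/((0.504)(0.498)π) = −(500/63)/(249π)`).
[cite: Zhang2022LandauSiegel, §12 (12.15)] -/
theorem g3T_thetaIota (w2 w3 w4 : ℂ) : g3T (thetaIota w2 w3 w4) = g3v := by
  unfold g3T g3v I6T overPi
  rw [thetaIota_L6, thetaIota_nu1, thetaIota_nu3, thetaIota_k1, thetaIota_k3]
  have hπ : (π : ℂ) ≠ 0 := by exact_mod_cast Real.pi_ne_zero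
  push_cast
  field_simp
  ring

/-- regression: `g₄(θ_ι) = g4v` (`(−0.004 − πi/250²)·4/((0.504)(0.5)π) = (−1/125 − πi/31250)(500/63)/π`).
[cite: Zhang2022LandauSiegel, §12 (12.15)] -/
theorem g4T_thetaIota (w2 w3 w4 : ℂ) : g4T (thetaIota w2 w3 w4) = g4v := by
  unfold g4T g4v I7T overPi
  rw [thetaIota_L7, thetaIota_nu1, thetaIota_nu2, thetaIota_k1, thetaIota_k2]
  have hπ : (π : ℂ) ≠ 0 := by exact_mod_cast Real.pi_ne_zero
  push_cast
  field_simp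
  ring

/-- [cite: Zhang2022LandauSiegel, (17.4)] -/
theorem vk1T_thetaIota (w2 w3 w4 : ℂ) : vk1T (thetaIota w2 w3 w4) = vk1one := by
  unfold vk1T; rw [thetaIota_nu1, thetaIota_k1, vkR_1]
/-- [cite: Zhang2022LandauSiegel, (17.4)] -/
theorem vk2T_thetaIota (w2 w3 w4 : ℂ) : vk2T (thetaIota w2 w3 w4) = vk2one := by
  unfold vk2T; rw [thetaIota_nu2, thetaIota_k2, vkR_2]
/-- [cite: Zhang2022LandauSiegel, (17.4)] -/
theorem vk3T_thetaIota (w2 w3 w4 : ℂ) : vk3T (thetaIota w2 w3 w4) = vk3one := by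
  unfold vk3T; rw [thetaIota_nu3, thetaIota_k3, vkR_3]
/-- [cite: Zhang2022LandauSiegel, (17.4), (2.27)] -/
theorem vk4T_thetaIota (w2 w3 w4 : ℂ) : vk4T (thetaIota w2 w3 w4) = vk4one := by
  unfold vk4T vk4one; exact vk2T_thetaIota w2 w3 w4

/-- regression: `F₂₀(θ_ι) = F20`. [cite: Zhang2022LandauSiegel, §18 (18.1)] -/
theorem F20T_thetaIota (w2 w3 w4 : ℂ) : F20T (thetaIota w2 w3 w4) = F20 := by
  unfold F20T F20
  simp only [e1pT_thetaIota, e3T_thetaIota, vk1T_thetaIota, vk3T_thetaIota, g3T_thetaIota]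
/-- regression: `F₂₁(θ_ι) = F21`. [cite: Zhang2022LandauSiegel, §18 (18.1)] -/
theorem F21T_thetaIota (w2 w3 w4 : ℂ) : F21T (thetaIota w2 w3 w4) = F21 := by
  unfold F21T F21
  simp only [e2T_thetaIota, e3T_thetaIota, vk2T_thetaIota, vk3T_thetaIota]
/-- regression: `F₃₀(θ_ι) = F30`. [cite: Zhang2022LandauSiegel, §18 (18.1)] -/
theorem F30T_thetaIota (w2 w3 w4 : ℂ) : F30T (thetaIota w2 w3 w4) = F30 := by
  unfold F30T F30
  simp only [e1pT_thetaIota, e2T_thetaIota, vk1T_thetaIota, vk4T_thetaIota, g4T_thetaIota]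
/-- regression: `F₃₁(θ_ι) = F31`. [cite: Zhang2022LandauSiegel, §18 (18.1)] -/
theorem F31T_thetaIota (w2 w3 w4 : ℂ) : F31T (thetaIota w2 w3 w4) = F31 := by
  unfold F31T F31
  simp only [e2T_thetaIota, vk2T_thetaIota, vk4T_thetaIota]

/-! ### The unreduced `𝔠₃`: the residual is affine in `ῑ₃, ῑ₄` too -/

/-- `𝔢_j(θ) = 𝔢′_j(θ) − 𝔢″_j(θ)` (Lemma 15.1's `e_{1j} = e′_{1j} − e″_{1j}` propagated).
[cite: Zhang2022LandauSiegel, §18 before (18.2)] -/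
theorem frakeT_eq_sub (θ : Theta) (j : ℕ) : frakeT θ j = frakepT θ j - frakeppT θ j := by
  unfold frakeT frakepT frakeppT e1T; ring

/-- **`𝔠₃(θ) = 𝔠₃ʳ(θ) + identResidual(θ)`**: the §18 reduction step is exactly the claim that the
residual is `ε`. [cite: Zhang2022LandauSiegel, §18 before (18.2)] -/
theorem frakc3T_eq_add (θ : Theta) : frakc3T θ = frakc3rT θ + identResidualT θ := by
  unfold frakc3T frakc3rT identResidualT
  rw [frakeT_eq_sub, frakeT_eq_sub, frakeT_eq_sub]
  ring

/-- The profiles `ffT k j` are continuous. [cite: Zhang2022LandauSiegel, §8 (8.13)–(8.18)] -/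
theorem continuous_ffT (k : ℝ) (j : ℕ) : Continuous (ffT k j) := by
  unfold ffT ffR; fun_prop

/-- `A₃ⱼ(θ) = ∫₀^{1−ν₁} 𝔣𝔣_{j,3}(ν₃ − z)/ν₃ dz`: the `ῑ₃`-part of `e*_{1j}(θ)`. [cite: Zhang2022LandauSiegel, §12 after (12.15)] -/
def A3T (θ : Theta) (j : ℕ) : ℂ := ∫ z in (0:ℝ)..θ.nu1pp, ffT θ.k3 j (θ.nu3 - z) / (θ.nu3 : ℂ)

/-- `A₂ⱼ(θ) = ∫₀^{1−ν₁} 𝔣𝔣_{j,2}(ν₂ − z)/ν₂ dz`: the `ῑ₄`-part of `e*_{1j}(θ)`. [cite: Zhang2022LandauSiegel, §12 after (12.15)] -/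
def A2T (θ : Theta) (j : ℕ) : ℂ := ∫ z in (0:ℝ)..θ.nu1pp, ffT θ.k2 j (θ.nu2 - z) / (θ.nu2 : ℂ)

/-- `e*_{1j}(θ) = ῑ₃A₃ⱼ(θ) + ῑ₄A₂ⱼ(θ)` (linearity of the integral; the integrands are continuous).
[cite: Zhang2022LandauSiegel, §12 after (12.15)] -/
theorem estar1T_eq (θ : Theta) (j : ℕ) : estar1T θ j = conj θ.iota3 * A3T θ j + conj θ.iota4 * A2T θ j := by
  unfold estar1T A3T A2T
  have h3 : Continuous fun z : ℝ => ffT θ.k3 j (θ.nu3 - z) / (θ.nu3 : ℂ) :=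
    ((continuous_ffT θ.k3 j).comp (by fun_prop)).div_const _
  have h2 : Continuous fun z : ℝ => ffT θ.k2 j (θ.nu2 - z) / (θ.nu2 : ℂ) :=
    ((continuous_ffT θ.k2 j).comp (by fun_prop)).div_const _
  have e : (fun z : ℝ => conj θ.iota3 * ffT θ.k3 j (θ.nu3 - z) / (θ.nu3 : ℂ)
      + conj θ.iota4 * ffT θ.k2 j (θ.nu2 - z) / (θ.nu2 : ℂ))
      = fun z : ℝ => conj θ.iota3 * (ffT θ.k3 j (θ.nu3 - z) / (θ.nu3 : ℂ))
      + conj θ.iota4 * (ffT θ.k2 j (θ.nu2 - z) / (θ.nu2 : ℂ)) := by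
    funext z; ring
  rw [e, intervalIntegral.integral_add ((h3.const_mul _).intervalIntegrable _ _)
    ((h2.const_mul _).intervalIntegrable _ _), intervalIntegral.integral_const_mul,
    intervalIntegral.integral_const_mul]

/-- `R₃(θ)`: coefficient of `ῑ₃` in the residual `i(3𝔢″₁ + 3𝔢″₂ + 𝔢″₃) + e₁*`.
[cite: Zhang2022LandauSiegel, §18 before (18.2)] -/
def R3T (θ : Theta) : ℂ :=
  I * (3 * (e1ppT θ 1 * e3T θ 1) + 3 * (e1ppT θ 2 * e3T θ 2) + e1ppT θ 3 * e3T θ 3)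
    - π * bstarT θ * (3 * A3T θ 1 + 6 * A3T θ 2 + 3 * A3T θ 3)

/-- `R₄(θ)`: coefficient of `ῑ₄` in the residual. [cite: Zhang2022LandauSiegel, §18 before (18.2)] -/
def R4T (θ : Theta) : ℂ :=
  I * (3 * (e1ppT θ 1 * e2T θ 1) + 3 * (e1ppT θ 2 * e2T θ 2) + e1ppT θ 3 * e2T θ 3)
    - π * bstarT θ * (3 * A2T θ 1 + 6 * A2T θ 2 + 3 * A2T θ 3)

/-- `identResidual(θ) = ῑ₃R₃(θ) + ῑ₄R₄(θ)`. [cite: Zhang2022LandauSiegel, §18 before (18.2)] -/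
theorem identResidualT_eq (θ : Theta) : identResidualT θ = conj θ.iota3 * R3T θ + conj θ.iota4 * R4T θ := by
  unfold identResidualT frakeppT e1starT R3T R4T
  rw [estar1T_eq, estar1T_eq, estar1T_eq]
  ring

/-- **The unreduced `𝔠₃(θ)` (the form inside `Skeleton.Margin232`) is affine in `ῑ₃, ῑ₄`** with
coefficients `F₂₀ + R₃`, `F₂₁`, `F₃₀ + R₄`, `F₃₁`. [cite: Zhang2022LandauSiegel, §18 (18.1)] -/
theorem frakc3T_eq (θ : Theta) :
    frakc3T θ = conj θ.iota3 * (F20T θ + R3T θ) + conj θ.iota3 * θ.iota2 * F21T θ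
      + conj θ.iota4 * (F30T θ + R4T θ) + conj θ.iota4 * θ.iota2 * F31T θ := by
  rw [frakc3T_eq_add, frakc3rT_eq, identResidualT_eq]
  ring

/-- [cite: Zhang2022LandauSiegel, §18 before (18.2)] -/
theorem A3T_withIota (θ : Theta) (w2 w3 w4 : ℂ) (j : ℕ) : A3T (θ.withIota w2 w3 w4) j = A3T θ j := rfl
/-- [cite: Zhang2022LandauSiegel, §18 before (18.2)] -/
theorem A2T_withIota (θ : Theta) (w2 w3 w4 : ℂ) (j : ℕ) : A2T (θ.withIota w2 w3 w4) j = A2T θ j := rfl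
/-- [cite: Zhang2022LandauSiegel, §18 before (18.2)] -/
theorem R3T_withIota (θ : Theta) (w2 w3 w4 : ℂ) : R3T (θ.withIota w2 w3 w4) = R3T θ := rfl
/-- [cite: Zhang2022LandauSiegel, §18 before (18.2)] -/
theorem R4T_withIota (θ : Theta) (w2 w3 w4 : ℂ) : R4T (θ.withIota w2 w3 w4) = R4T θ := rfl

/-- `margin232LHS = C232T + 2 Re identResidual + 2·10⁻⁵`. [cite: Zhang2022LandauSiegel, §18 p. 99] -/
theorem margin232LHS_eq (θ : Theta) (c1 c2 : ℂ) :
    margin232LHS θ c1 c2 = C232T θ c1 c2 + 2 * (identResidualT θ).re + 2e-5 := by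
  unfold margin232LHS C232T
  rw [frakc3T_eq_add, Complex.add_re]
  ring

/-! ### The parametric `4 × 4` matrix and the form identities -/

/-- The matrix of the Hermitian form `x ↦ 𝔠₁ + 𝔠₂ + 𝔠₃ + 𝔠̄₃ − m|x₀|²` in `x = (1, ι₂, ι₃, ι₄)` with
all entries as parameters (`Section18AllIota.QM` is the instance at the tree's constants):
rows/columns `(1, ι₂, ι₃, ι₄)`. [cite: Zhang2022LandauSiegel, (2.32), §18] -/
def QP (c11 c12 c22 c33 c34 c44 F20 F21 F30 F31 : ℂ) (m : ℚ) : Matrix (Fin 4) (Fin 4) ℂ :=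
  !![c11 - (m : ℂ), conj c12, conj F20, conj F30;
     c12, c22, conj F21, conj F31;
     F20, F21, c33, conj c34;
     F30, F31, c34, c44]

/-- `QP` at the tree's constants is `Section18AllIota.QM`. [cite: Zhang2022LandauSiegel, (2.32), §18] -/
theorem QP_eq_QM (c34x : ℂ) (m : ℚ) : QP c11 c12 c22 c33 c34x c44 F20 F21 F30 F31 m = QM c34x m := rfl

/-- **Form identity** (pure algebra): `x* QP x = (c₁₁ + w₂c̄₁₂ + w̄₂c₁₂ + |w₂|²c₂₂)
+ (|w₃|²c₃₃ + w₃w̄₄c₃₄ + w₄w̄₃c̄₃₄ + |w₄|²c₄₄) + L + L̄ − m` with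
`L = w̄₃F₂₀ + w̄₃w₂F₂₁ + w̄₄F₃₀ + w̄₄w₂F₃₁`. [cite: Zhang2022LandauSiegel, (2.32), §18] -/
theorem form_QP (c11 c12 c22 c33 c34 c44 F20 F21 F30 F31 : ℂ) (m : ℚ) (w2 w3 w4 : ℂ) :
    star (xvec w2 w3 w4) ⬝ᵥ (QP c11 c12 c22 c33 c34 c44 F20 F21 F30 F31 m *ᵥ xvec w2 w3 w4)
      = (c11 + w2 * conj c12 + conj w2 * c12 + (Complex.normSq w2 : ℂ) * c22)
        + ((Complex.normSq w3 : ℂ) * c33 + w3 * conj w4 * c34 + w4 * conj w3 * conj c34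
            + (Complex.normSq w4 : ℂ) * c44)
        + (conj w3 * F20 + conj w3 * w2 * F21 + conj w4 * F30 + conj w4 * w2 * F31)
        + conj (conj w3 * F20 + conj w3 * w2 * F21 + conj w4 * F30 + conj w4 * w2 * F31) - (m : ℂ) := by
  simp only [QP, xvec, Matrix.mulVec, dotProduct, Fin.sum_univ_four, Matrix.of_apply, Matrix.cons_val',
    Matrix.cons_val_zero, Matrix.cons_val_one, Matrix.cons_val, Matrix.empty_val', Matrix.cons_val_fin_one,
    Pi.star_apply, Complex.star_def, map_one, map_add, map_mul, Complex.conj_conj, Complex.normSq_eq_conj_mul_self]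
  ring

/-- **Bridge to the margin functional (reduced form)**: if the feeders are the Hermitian forms of the
`§8/§9` blocks, `Re(x* QP(c··, F··(θ), m) x) = C232T θ c₁ c₂ − m`. [cite: Zhang2022LandauSiegel, (2.32), §18] -/
theorem C232T_form_re (θ : Theta) {c1 c2 c11 c12 c22 c33 c34 c44 : ℂ} (m : ℚ)
    (h1 : c1 = c11 + θ.iota2 * conj c12 + conj θ.iota2 * c12 + (Complex.normSq θ.iota2 : ℂ) * c22)
    (h2 : c2 = (Complex.normSq θ.iota3 : ℂ) * c33 + θ.iota3 * conj θ.iota4 * c34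
      + θ.iota4 * conj θ.iota3 * conj c34 + (Complex.normSq θ.iota4 : ℂ) * c44) :
    (star (xvec θ.iota2 θ.iota3 θ.iota4) ⬝ᵥ
      (QP c11 c12 c22 c33 c34 c44 (F20T θ) (F21T θ) (F30T θ) (F31T θ) m *ᵥ xvec θ.iota2 θ.iota3 θ.iota4)).re
      = C232T θ c1 c2 - m := by
  rw [form_QP]
  unfold C232T
  rw [frakc3rT_eq, h1, h2]
  simp only [Complex.sub_re, Complex.add_re, Complex.conj_re, Complex.ratCast_re]
  ring

/-- **Bridge (unreduced form)**: with `F₂₀ + R₃`, `F₃₀ + R₄` the same identity gives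
`margin232LHS θ c₁ c₂ − 2·10⁻⁵ − m`. [cite: Zhang2022LandauSiegel, §18 p. 99] -/
theorem margin232LHS_form_re (θ : Theta) {c1 c2 c11 c12 c22 c33 c34 c44 : ℂ} (m : ℚ)
    (h1 : c1 = c11 + θ.iota2 * conj c12 + conj θ.iota2 * c12 + (Complex.normSq θ.iota2 : ℂ) * c22)
    (h2 : c2 = (Complex.normSq θ.iota3 : ℂ) * c33 + θ.iota3 * conj θ.iota4 * c34
      + θ.iota4 * conj θ.iota3 * conj c34 + (Complex.normSq θ.iota4 : ℂ) * c44) :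
    (star (xvec θ.iota2 θ.iota3 θ.iota4) ⬝ᵥ
      (QP c11 c12 c22 c33 c34 c44 (F20T θ + R3T θ) (F21T θ) (F30T θ + R4T θ) (F31T θ) m
        *ᵥ xvec θ.iota2 θ.iota3 θ.iota4)).re
      = margin232LHS θ c1 c2 - 2e-5 - m := by
  have hC := C232T_form_re θ m h1 h2
  rw [form_QP] at hC ⊢
  rw [margin232LHS_eq, identResidualT_eq]
  have split : conj θ.iota3 * (F20T θ + R3T θ) + conj θ.iota3 * θ.iota2 * F21T θ
      + conj θ.iota4 * (F30T θ + R4T θ) + conj θ.iota4 * θ.iota2 * F31T θ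
      = (conj θ.iota3 * F20T θ + conj θ.iota3 * θ.iota2 * F21T θ + conj θ.iota4 * F30T θ
          + conj θ.iota4 * θ.iota2 * F31T θ) + (conj θ.iota3 * R3T θ + conj θ.iota4 * R4T θ) := by
    ring
  rw [split]
  simp only [map_add, Complex.add_re, Complex.sub_re, Complex.conj_re, Complex.ratCast_re] at hC ⊢
  linarith

/-- From positive semidefiniteness to the floor, reduced form: `QP(…, F··(θ), m) ⪰ 0 → m ≤ C232T θ c₁ c₂`.
[cite: Zhang2022LandauSiegel, (2.32), §18] -/
theorem C232T_ge_of_posSemidef (θ : Theta) {c1 c2 c11 c12 c22 c33 c34 c44 : ℂ} {m : ℚ}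
    (h1 : c1 = c11 + θ.iota2 * conj c12 + conj θ.iota2 * c12 + (Complex.normSq θ.iota2 : ℂ) * c22)
    (h2 : c2 = (Complex.normSq θ.iota3 : ℂ) * c33 + θ.iota3 * conj θ.iota4 * c34
      + θ.iota4 * conj θ.iota3 * conj c34 + (Complex.normSq θ.iota4 : ℂ) * c44)
    (hQ : (QP c11 c12 c22 c33 c34 c44 (F20T θ) (F21T θ) (F30T θ) (F31T θ) m).PosSemidef) :
    (m : ℝ) ≤ C232T θ c1 c2 := by
  have h0 := hQ.dotProduct_mulVec_nonneg (xvec θ.iota2 θ.iota3 θ.iota4)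
  rw [Complex.nonneg_iff] at h0
  have h := h0.1
  rw [C232T_form_re θ m h1 h2] at h
  simpa using h

/-- From positive semidefiniteness to the floor, unreduced form:
`QP(…, F₂₀+R₃, F₂₁, F₃₀+R₄, F₃₁, m) ⪰ 0 → m + 2·10⁻⁵ ≤ margin232LHS θ c₁ c₂`. [cite: Zhang2022LandauSiegel, §18 p. 99] -/
theorem margin232LHS_ge_of_posSemidef (θ : Theta) {c1 c2 c11 c12 c22 c33 c34 c44 : ℂ} {m : ℚ}
    (h1 : c1 = c11 + θ.iota2 * conj c12 + conj θ.iota2 * c12 + (Complex.normSq θ.iota2 : ℂ) * c22)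
    (h2 : c2 = (Complex.normSq θ.iota3 : ℂ) * c33 + θ.iota3 * conj θ.iota4 * c34
      + θ.iota4 * conj θ.iota3 * conj c34 + (Complex.normSq θ.iota4 : ℂ) * c44)
    (hQ : (QP c11 c12 c22 c33 c34 c44 (F20T θ + R3T θ) (F21T θ) (F30T θ + R4T θ) (F31T θ) m).PosSemidef) :
    (m : ℝ) + 2e-5 ≤ margin232LHS θ c1 c2 := by
  have h0 := hQ.dotProduct_mulVec_nonneg (xvec θ.iota2 θ.iota3 θ.iota4)
  rw [Complex.nonneg_iff] at h0
  have h := h0.1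
  rw [margin232LHS_form_re θ m h1 h2] at h
  linarith

/-- regression: on the printed `ι`-family the reduced bridge with the tree's `c··` reproduces
`Section18AllIota.form_QM_re` (`C232X c₃₄ c̄₃₄`). [cite: Zhang2022LandauSiegel, (2.32), §18] -/
theorem C232T_form_re_thetaIota (m : ℚ) (w2 w3 w4 : ℂ) :
    (star (xvec w2 w3 w4) ⬝ᵥ (QM c34 m *ᵥ xvec w2 w3 w4)).re
      = C232T (thetaIota w2 w3 w4) (frakc1G w2) (frakc2G w3 w4) - m := by
  rw [form_QM_re, C232T_thetaIota]; rfl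

end Repair

end Literature.NumberTheory.LFunctions.Zhang2022
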